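/-
Copyright (c) 2026 the pub-hodgecm-mathlib formalisation cell (harness21).  Prover seat hodgecm-mathlib-LH10-p02 (g15); E1 keeper ∕ dealer F0P3a-p03 (g31)
k104 «ROW 78 (X2a)» on the EXT-ROAD census of LH6-p04 (g12), part (E5) «sub-exponent ⇔ quotient-exponent».
-/
import Literature.LinearAlgebra.CommutingFamilyBlockExact   -- ★-to-be row 78 FILE 1 (this seat): §2 joint eigenvector, §3 eigen-functionals kill other blocks, §4 complement
import Mathlib.LinearAlgebra.Dual.Lemmas
import HarnessLib

/-!
# Joint generalised eigenspaces of a commuting family, ARBITRARY index set: «SUB-EXPONENT ⇔ QUOTIENT-EXPONENT»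

Generic linear algebra over an algebraically closed field `K` in finite dimension (Mathlib + ★ `CommutingFamilyBlockExact`; THEOREMS ONLY).  Namespace
`Literature.LinearAlgebra.CommutingFamily` (continued).  Cell `pub/hodgecm-mathlib`, crux H413 = `stmt-HodgeConjecture-24833` (`--supports` lane, count-neutral helper); E1 row 78
FILE 2 = part (E5) of brick (X2a) of the EXT-ROAD (LH6-p04 (g12)): on the finite-dimensional Jacquet module of an admissible representation over the (infinite, commutative)
torus, a character occurs as a joint EIGENVECTOR («sub-exponent», ★ `Representation.HasJacquetExponent`) iff it occurs as a joint EIGEN-FUNCTIONAL («quotient-exponent», the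
currency Frobenius reciprocity ★ `normalizedJacquetHomEquiv` turns into an embedding into `i_G(χ)`).

* `exists_eigenFunctional_ne_zero_of_iInf_maxGenEigenspace_ne_bot` — a non-zero `χ`-block yields a NON-ZERO `χ`-eigen-functional `Λ` (`Λ (f i v) = χ i * Λ v`): apply ★ §2
  (joint eigenvector, any index set) to the DUAL family `(f i|_W)ᵛ` on the dual of the block `W` (whose `χ`-block is everything), and extend by `0` on the other blocks (★ §4).
* `iInf_maxGenEigenspace_ne_bot_of_eigenFunctional_ne_zero` — conversely a non-zero `χ`-eigen-functional forces the `χ`-block to be non-zero (it kills the other blocks, ★ §3,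
  which would otherwise span).
* `exists_eigenvector_iff_exists_eigenFunctional` — **«SUB-EXPONENT ⇔ QUOTIENT-EXPONENT»**: `(∃ w ≠ 0, ∀ i, f i w = χ i • w) ↔ (∃ Λ ≠ 0, ∀ i v, Λ (f i v) = χ i * Λ v)`.
HONEST LABEL: count-neutral generic helper; nothing printed is asserted; the EXT-ROAD is a road CANDIDATE pending the LEAD's price; h413 OPEN; HC_CM is proved only modulo the 7
printed citations (2 remaining named inputs hLiu418 = stmt-HodgeConjecture-24832, h413 = stmt-HodgeConjecture-24833) until rung 0 closes.

## References
* [BernsteinZelevinsky1977] I. N. Bernstein, A. V. Zelevinsky, *Induced representations of reductive p-adic groups I*, Ann. Sci. ÉNS 10 (1977), §2.3.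
* [Casselman1995] W. Casselman, *Introduction to the theory of admissible representations of p-adic reductive groups* (draft 1995), §3.2 Prop. 3.2.3, Thm. 3.2.4 (Frobenius reciprocity), §4.4 p. 45, §6.3
  (exponents as sub- vs quotient-characters of the Jacquet module).
* [KnappVogan1995] A. W. Knapp, D. A. Vogan, *Cohomological Induction and Unitary Representations* (1995), §VII.2 Cor. 7.27.
-/

set_option autoImplicit false

namespace Literature.LinearAlgebra.CommutingFamily

open Function Set Module Module.End

variable {K : Type*} [Field K] {ι : Type*} {V : Type*} [AddCommGroup V] [Module K V]

/-- Powers and the dual map: `((a − c•1)ⁿ)ᵛ μ = μ ∘ (a − c•1)ⁿ` pointwise, i.e. `(((aᵛ) − c•1)ⁿ μ) x = μ ((a − c•1)ⁿ x)`. [cite: Casselman1995, §3.2 Prop. 3.2.3] -/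
theorem dualMap_sub_smul_one_pow_apply {W : Type*} [AddCommGroup W] [Module K W] (a : Module.End K W) (c : K) (n : ℕ) (μ : Module.Dual K W) (x : W) :
    (((a.dualMap : Module.End K (Module.Dual K W)) - c • (1 : Module.End K (Module.Dual K W))) ^ n) μ x = μ (((a - c • (1 : Module.End K W)) ^ n) x) := by
  induction n generalizing μ x with
  | zero => simp
  | succ n ih =>
    rw [pow_succ, Module.End.mul_apply, ih, pow_succ', Module.End.mul_apply]
    simp only [LinearMap.sub_apply, LinearMap.smul_apply, Module.End.one_apply, LinearMap.dualMap_apply, map_sub, map_smul, smul_eq_mul]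

variable [FiniteDimensional K V] [IsAlgClosed K]

/-- **A NON-ZERO `χ`-BLOCK YIELDS A NON-ZERO `χ`-EIGEN-FUNCTIONAL** («sub-exponent ⇒ quotient-exponent»; commuting family, any index set, finite dimension over an
algebraically closed field): if `⨅ i, (f i).maxGenEigenspace (χ i) ≠ ⊥` there is `Λ : V → K`, `Λ ≠ 0`, with `Λ (f i v) = χ i * Λ v` for all `i, v`.  Proof: on the dual of the
block `W` the dual family `(f i|_W)ᵛ` commutes and has `χ`-block EVERYTHING (`(f i − χ i)` is nilpotent on `W` with exponent `≤ dim V`), so ★ §2 gives a joint eigenvector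
`μ ≠ 0` of the dual family, i.e. `μ (f i x) = χ i * μ x` on `W`; extend `μ` by `0` on the span of the other blocks (★ §4 complement).
[cite: Casselman1995, §4.4 p. 45, §6.3] [cite: BernsteinZelevinsky1977, §2.3] [cite: KnappVogan1995, §VII.2 Cor. 7.27] -/
theorem exists_eigenFunctional_ne_zero_of_iInf_maxGenEigenspace_ne_bot (f : ι → Module.End K V) (hc : ∀ i j, Commute (f i) (f j)) (χ : ι → K)
    (hne : (⨅ i, (f i).maxGenEigenspace (χ i)) ≠ ⊥) :
    ∃ Λ : V →ₗ[K] K, Λ ≠ 0 ∧ ∀ i v, Λ (f i v) = χ i * Λ v := by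
  set W : Submodule K V := ⨅ i, (f i).maxGenEigenspace (χ i) with hWdef
  have hW : ∀ i, ∀ x ∈ W, f i x ∈ W := fun i x hx => apply_mem_iInf_maxGenEigenspace_of_forall_commute f (fun j => hc j i) χ hx
  -- the restricted family on `W` and its dual family on `Dual K W`
  let g : ι → Module.End K W := fun i => (f i).restrict (hW i)
  let d : ι → Module.End K (Module.Dual K W) := fun i => (g i).dualMap
  have hgc : ∀ i j, Commute (g i) (g j) := fun i j => by
    show g i * g j = g j * g i
    refine LinearMap.ext fun x => Subtype.ext ?_
    show f i (f j (x : V)) = f j (f i (x : V))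
    rw [← Module.End.mul_apply, (hc i j).eq, Module.End.mul_apply]
  have hdc : ∀ i j, Commute (d i) (d j) := fun i j => by
    show (g i).dualMap * (g j).dualMap = (g j).dualMap * (g i).dualMap
    rw [Module.End.mul_eq_comp, Module.End.mul_eq_comp, LinearMap.dualMap_comp_dualMap, LinearMap.dualMap_comp_dualMap, ← Module.End.mul_eq_comp,
      ← Module.End.mul_eq_comp, (hgc j i).eq]
  -- the `χ`-block of the dual family is all of `Dual K W`
  have htop : (⨅ i, (d i).maxGenEigenspace (χ i)) = ⊤ := by
    rw [eq_top_iff]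
    intro μ _
    rw [Module.End.mem_iInf_maxGenEigenspace_iff]
    intro i
    refine ⟨Module.finrank K V, LinearMap.ext fun x => ?_⟩
    rw [LinearMap.zero_apply, dualMap_sub_smul_one_pow_apply]
    -- `(g i − χ i)^(dim V) x = 0` since `x ∈ W ≤ maxGenEigenspace (f i) (χ i) = genEigenspace _ _ (dim V)`
    have hx : ((f i - χ i • (1 : Module.End K V)) ^ Module.finrank K V) (x : V) = 0 := by
      have hxW : (x : V) ∈ (f i).maxGenEigenspace (χ i) := (Submodule.mem_iInf _).1 x.2 i
      rw [Module.End.maxGenEigenspace_eq_genEigenspace_finrank, Module.End.mem_genEigenspace_nat] at hxW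
      exact hxW
    have hsub : (W.subtype) ∘ₗ g i = f i ∘ₗ W.subtype := LinearMap.ext fun y => rfl
    have h2 : ((((g i - χ i • (1 : Module.End K W)) ^ Module.finrank K V) x : W) : V) =
        ((f i - χ i • (1 : Module.End K V)) ^ Module.finrank K V) (x : V) :=
      apply_sub_smul_one_pow_eq W.subtype hsub (χ i) (Module.finrank K V) x
    rw [hx] at h2
    have h3 : ((g i - χ i • (1 : Module.End K W)) ^ Module.finrank K V) x = 0 := Subtype.ext h2
    rw [h3, map_zero]
  -- `Dual K W ≠ 0`, so ★ §2 gives a joint eigen-functional `μ ≠ 0` on `W`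
  haveI : Nontrivial W := by
    obtain ⟨w, hw, hw0⟩ := (Submodule.ne_bot_iff W).1 hne
    exact ⟨⟨⟨w, hw⟩, 0, fun h => hw0 (congrArg Subtype.val h)⟩⟩
  have hdne : (⨅ i, (d i).maxGenEigenspace (χ i)) ≠ ⊥ := by rw [htop]; exact top_ne_bot
  obtain ⟨μ, hμ0, -, hμ⟩ := exists_eigenvector_of_iInf_maxGenEigenspace_ne_bot d hdc χ hdne
  have hμ' : ∀ i (x : W), μ (g i x) = χ i * μ x := fun i x => by
    have := LinearMap.congr_fun (hμ i) x
    rwa [LinearMap.dualMap_apply, LinearMap.smul_apply, smul_eq_mul] at this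
  -- extend by `0` on the other blocks
  have hcompl := isCompl_iInf_maxGenEigenspace_iSup_ne f hc χ
  refine ⟨LinearMap.ofIsCompl hcompl μ 0, ?_, ?_⟩
  · -- non-zero: `μ w ≠ 0` for some `w ∈ W`
    obtain ⟨w, hw⟩ : ∃ w : W, μ w ≠ 0 := by
      by_contra h
      exact hμ0 (LinearMap.ext fun w => (not_not.1 (not_exists.1 h w)).trans (LinearMap.zero_apply w).symm)
    intro h0
    apply hw
    have := LinearMap.congr_fun h0 (w : V)
    rwa [LinearMap.ofIsCompl_apply_left hcompl (u := w), LinearMap.zero_apply] at this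
  · intro i v
    have hv : v ∈ ⨆ ψ : ι → K, ⨅ j, (f j).maxGenEigenspace (ψ j) := by
      rw [iSup_iInf_maxGenEigenspace_eq_top_of_finiteDimensional f hc]; exact Submodule.mem_top
    induction hv using Submodule.iSup_induction' with
    | mem ψ v hv =>
      have hfv : f i v ∈ ⨅ j, (f j).maxGenEigenspace (ψ j) := apply_mem_iInf_maxGenEigenspace_of_forall_commute f (fun j => hc j i) ψ hv
      by_cases hψ : ψ = χ
      · subst hψ
        rw [LinearMap.ofIsCompl_apply_left hcompl (u := ⟨v, hv⟩), LinearMap.ofIsCompl_apply_left hcompl (u := ⟨f i v, hfv⟩)]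
        have : (⟨f i v, hfv⟩ : W) = g i ⟨v, hv⟩ := Subtype.ext rfl
        rw [this, hμ']
      · have hv' : v ∈ ⨆ (ψ : ι → K) (_ : ψ ≠ χ), ⨅ j, (f j).maxGenEigenspace (ψ j) := Submodule.mem_iSup_of_mem ψ (Submodule.mem_iSup_of_mem hψ hv)
        have hfv' : f i v ∈ ⨆ (ψ : ι → K) (_ : ψ ≠ χ), ⨅ j, (f j).maxGenEigenspace (ψ j) := Submodule.mem_iSup_of_mem ψ (Submodule.mem_iSup_of_mem hψ hfv)
        rw [LinearMap.ofIsCompl_apply_right hcompl (v := ⟨v, hv'⟩), LinearMap.ofIsCompl_apply_right hcompl (v := ⟨f i v, hfv'⟩)]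
        simp
    | zero => simp
    | add x y _ _ hx hy => rw [map_add, map_add, hx, hy, map_add, mul_add]

/-- **A NON-ZERO `χ`-EIGEN-FUNCTIONAL FORCES A NON-ZERO `χ`-BLOCK** («quotient-exponent ⇒ sub-exponent»): `Λ` kills every other block (★ §3); were the `χ`-block `0`, the
other blocks would span (★ §4) and `Λ = 0`. [cite: Casselman1995, §4.4 p. 45, §6.3] [cite: BernsteinZelevinsky1977, §2.3] -/
theorem iInf_maxGenEigenspace_ne_bot_of_eigenFunctional_ne_zero (f : ι → Module.End K V) (hc : ∀ i j, Commute (f i) (f j)) (χ : ι → K)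
    (Λ : V →ₗ[K] K) (hΛ0 : Λ ≠ 0) (hΛ : ∀ i v, Λ (f i v) = χ i * Λ v) :
    (⨅ i, (f i).maxGenEigenspace (χ i)) ≠ ⊥ := by
  intro hbot
  apply hΛ0
  have hcompl := isCompl_iInf_maxGenEigenspace_iSup_ne f hc χ
  rw [hbot] at hcompl
  have htop : (⨆ (ψ : ι → K) (_ : ψ ≠ χ), ⨅ j, (f j).maxGenEigenspace (ψ j)) = ⊤ := eq_top_of_bot_isCompl hcompl
  refine LinearMap.ext fun v => ?_
  rw [LinearMap.zero_apply]
  exact eigenFunctional_eq_zero_of_mem_iSup_ne f χ Λ hΛ (htop ▸ Submodule.mem_top)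

/-- **«SUB-EXPONENT ⇔ QUOTIENT-EXPONENT»** for a commuting family (any index set) on a finite-dimensional space over an algebraically closed field: `χ` occurs as a joint
EIGENVECTOR iff it occurs as a joint EIGEN-FUNCTIONAL.  (On the Jacquet module `r_B π` of an admissible `π`: `χ` is an exponent in the eigenvector sense ★
`HasJacquetExponent` iff `Hom_M(r_B π, χ) ≠ 0`, which Frobenius reciprocity reads as `π ↪ i_G(χ)`-data.) [cite: Casselman1995, §3.2 Thm. 3.2.4, §4.4 p. 45, §6.3]
[cite: BernsteinZelevinsky1977, §2.3] -/
theorem exists_eigenvector_iff_exists_eigenFunctional (f : ι → Module.End K V) (hc : ∀ i j, Commute (f i) (f j)) (χ : ι → K) :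
    (∃ w : V, w ≠ 0 ∧ ∀ i, f i w = χ i • w) ↔ ∃ Λ : V →ₗ[K] K, Λ ≠ 0 ∧ ∀ i v, Λ (f i v) = χ i * Λ v := by
  rw [← iInf_maxGenEigenspace_ne_bot_iff_exists_eigenvector f hc χ]
  exact ⟨exists_eigenFunctional_ne_zero_of_iInf_maxGenEigenspace_ne_bot f hc χ,
    fun ⟨Λ, hΛ0, hΛ⟩ => iInf_maxGenEigenspace_ne_bot_of_eigenFunctional_ne_zero f hc χ Λ hΛ0 hΛ⟩

end Literature.LinearAlgebra.CommutingFamily
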